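import Summits.HodgeConjecture.HodgeConjecture.Theorems.Ring2AbelianAllOneSplitWeilAnchorCarrierDefs
import Literature.AlgebraicGeometry.HodgeTheory.BlochSemiregularSpreadOfSubscheme
import Literature.AlgebraicGeometry.HodgeTheory.HardLefschetzNFold
import HarnessLib

/-!
# Ring 2 / AbelianAll (André column) — the node «ONE BLOCH-SEMIREGULAR LOCAL COMPLETE INTERSECTION, IN A SHIFTED DEGREE, AT ONE SPLIT ANCHOR OF
# OUR CHOICE PER TYPE `(E, p)`» (definitions only)

research route, not a corollary; conditional on HC_CM plus one named minimal statement.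

DEFINITIONS ONLY (nothing asserted, nothing proved; `HC_CM` absent). PART AH (gen 65). The nodes of PART AF ∕ AG
(`OneSplitWeilAnchorChartCarriers 𝒪 R e₀ p` and its cells) ask, at one split anchor `(X₀, η₀, h₀)` of type `(R, e₀, p)`, an `𝒪`-datum
whose degree-`2p` class is `a·w + c·θᵖ` for a non-zero rational `E`-Weil class `w ∈ H^{2p}` — the Weil class is carried IN ITS OWN DEGREE.
Two theorems of the tree make the degree a free parameter:

* LIEBERMAN (`B(A)`, hence `A(A, θ)`, for every complex abelian variety — `Ring2.Binders.standardConjectureA_of_iso_abelianVariety`,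
  `Ring2.Binders.mem_algebraicClasses_of_lefschetzPowTo_mem`): on an abelian `n`-fold, `θʲ ∪ w` algebraic ⟹ `w` algebraic (`2p + j ≤ n`);
* BLOCH 1972, Thm. (7.4) with Remark (7.5), for an ARBITRARY local complete intersection subscheme (the tree's refereed named fact
  `BlochSemiregularSpreadOfSubscheme n q`, any `(n, q)`): a Bloch-semiregular l.c.i. `Z₀ ⊂ X₀` of codimension `q` with
  `[Z₀] = a·z₀ + b·L₀` (`a ≠ 0`; `L` any global class algebraic on every fibre) spreads the algebraicity of the horizontal class `z` off `s₀`
  — with NO side conditions in other degrees (the Hilbert scheme's obstruction space `H¹(Z₀, N)` only sees `[Z₀]`).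

Hence the carrier may sit in ANY degree `2(p + j)`, `0 ≤ j ≤ n − 2p`: a Bloch-semiregular l.c.i. subscheme `Z ⊂ X` of codimension `p + j` with
`[Z] = a·(θʲ ∪ w) + b·θ^{p+j}`. For the smallest open cell of the column — split Weil EIGHTFOLDS with a QUARTIC CM field, `p = 2` — the three
geometric incarnations are: `j = 0` a SIXFOLD of class `a·w + b·θ²` (outside the Whitney range: whether `a·w + b·θ²` is the class of ANY smooth
subvariety is an instance of the open ℚ-smoothability question, Kleiman 1969 ∕ Kollár–Voisin 2024 ∕ Benoist–Voisin 2024; complete intersections of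
two divisors are semiregular but never have this class, PART AG Thm. AG.5); `j = 2` a FOURFOLD of class `a·θ²w + b·θ⁴` (boundary of the Whitney
range); `j = 4` a SURFACE of class `a·θ⁴w + b·θ⁶` (inside the Whitney range `2 < 8/2`: the class IS that of a smooth irreducible surface by
Hironaka 1968 ∕ Kollár–Voisin 2024, and `θ⁴·(2w + 8N²θ²)` is even a sum of eight classes of pairwise disjoint smooth complete-intersection surfaces
(memo SHIFTED-CARRIERS-g65 §3) — but a complete intersection of six ample divisors on an abelian eightfold is NEVER Bloch-semiregular:
`h¹(N) ≥ 6·h^{0,2} = 168·6 = 1008 > 448 = h^{5,7}` (memo §5); the find-the-object problem is an IRREDUCIBLE semiregular surface).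

* `blochShiftedCarriedClasses n p j X θ` (served-class map, reducible): the classes `w ∈ H^{2p}(X(ℂ); ℂ)` such that SOME Bloch-semiregular local
  complete intersection `i : Z ↪ X` of codimension `p + j` has fundamental class `[Z] = a·Lʲ_θ w + b·θ^{p+j}` with integers `a ≠ 0`, `b` (the binders
  of `BlochSemiregularSpreadOfSubscheme n (p + j)` verbatim: `IsRegularImmersionOfCodim`, the codimension clause, `IsBlochSemiregular`, the cycle in
  `Z_d(X)`, `subschemeClass`).
* `OneSplitWeilAnchorBlochShiftedCarriers R e₀ p j` (`@[conjecture]`, `∀∃` chart form as `OneSplitWeilAnchorChartCarriers`): ONE split anchor of type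
  `(R, e₀, p)` of our choice at every chart of which SOME non-zero rational class of its `E`-Weil line lies in `blochShiftedCarriedClasses (dim X₀) p j X θ`.
* `OneSplitWeilAnchorBlochCarriersAll` (`@[conjecture]`): for every inhabited type `(R, e₀, p)`, `p > 1`, SOME shift `j` with `2p + j ≤ dim` and
  `OneSplitWeilAnchorBlochShiftedCarriers R e₀ p j` — the Bloch-door form of the André column's carrier input (ii), the shift free per type.
* `QuarticSplitEightfoldAnchorBlochCarrier j` (`@[conjecture]`, argument `j ∈ {0, …, 4}`): the `(8,2)` quartic cell in shifted degree `2(2 + j)`.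

Companion engine + rows (route-free): `VHCAbelianSchemesRoadWeilLineBlochShifted`. Every node is OPEN, NOT implied by the Hodge conjecture (it asks for
SEMIREGULAR subschemes, Bloch's «wide open» problem of Remark (7.5)), a HYPOTHESIS wherever used. References: [cite: Bloch1972Semiregularity, Thm. (7.4),
Remark (7.5) (p. 65) and §0 (p. 51)] [cite: BuchweitzFlenner2003, Thm. 5.2 and (8.1)] [cite: Lieberman1968, main theorem] [cite: Kleiman1968AlgebraicCycles,
§2 (A(X)) and Appendix Thm. 2A11] [cite: Andre1996Motifs, §6.3 b) (*) (p. 32), proof of Lemme 6.3.3 (p. 33)] [cite: Deligne1982HodgeCycles, §4 proof of Thm. 4.8]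
[cite: MoonenZarhin1998WeilClasses, §1] [cite: Fulton1998, §1.5 and §19.1].
-/

noncomputable section

open CategoryTheory AlgebraicGeometry

namespace Summit.HodgeConjecture.HodgeConjecture.Ring2.AbelianAll

-- the cell's namespace repeats the summit name (`Summit.HodgeConjecture.HodgeConjecture…`), as in every `Ring2*` file
set_option linter.dupNamespace false

open Literature.AlgebraicGeometry Literature.AlgebraicGeometry.Motives
open Literature.AlgebraicGeometry.HodgeTheory
open Literature.AlgebraicGeometry.Deligne1982
open Literature.AlgebraicGeometry.VanGeemen1994 (pullbackOne)
open Literature.AlgebraicTopology.SingularHomology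

/-- **The classes on `(X, θ)` CARRIED IN THE SHIFTED DEGREE `2(p + j)` BY A BLOCH-SEMIREGULAR LOCAL COMPLETE INTERSECTION**
(`blochShiftedCarriedClasses n p j X θ`, served-class map, reducible): `w ∈ H^{2p}(X(ℂ); ℂ)` such that there are a closed subscheme `i : Z ↪ X`
which is a local complete intersection of codimension `p + j` (`IsRegularImmersionOfCodim`, codimension `≥ p + j` at every point of its support),
Bloch-semiregular in the smooth projective `n`-fold `X` (`IsBlochSemiregular i n (p + j)`: the semiregularity map `H¹(Z, N) → H^{p+j+1}(X, Ω^{p+j-1})`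
injective), with its cycle `[Z] = Σ mᵢ[Zᵢ]` read in dimension `d`, `d + (p + j) = n`, and integers `a ≠ 0`, `b` with
`a·Lʲ_θ(w) + b·θ^{p+j} = [Z] ∈ H^{2(p+j)}(X(ℂ); ℂ)` (`subschemeClass`, complex orientations, any resolution family `ρ`) — EXACTLY the seed of the
tree's named fact `BlochSemiregularSpreadOfSubscheme n (p + j)` in the weakened form of Bloch's Remark (7.5), for the horizontal class `Θʲ ∪ W` and
the fibrewise algebraic class `Θ^{p+j}`. For `j = 0` this is Bloch's own format `a·w + b·θᵖ = [Z]`. [cite: Bloch1972Semiregularity, Thm. (7.4) and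
Remark (7.5) (p. 65), §0 (p. 51)] [cite: BuchweitzFlenner2003, Thm. 5.2 and (8.1)] [cite: Fulton1998, §1.5 and §19.1] -/
abbrev blochShiftedCarriedClasses (n p j : ℕ) (X : SchemeOver ℂ) (θ : complexBetti X 2) : Set (complexBetti X (2 * p)) :=
  {w | ∃ (hX : IsSmoothProjective n X) (d : ℕ) (hdp : d + (p + j) = n) (ρ : ResolutionFamily X d)
      (Z : Scheme.{0}) (_ : IsLocallyNoetherian Z) (i : Z ⟶ X.left) (hi : IsClosedImmersion i) (a b : ℤ),
      IsRegularImmersionOfCodim i (p + j) ∧ (∀ z ∈ Set.range i.base, ((p + j : ℕ) : ℕ∞) ≤ Order.coheight z) ∧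
      IsBlochSemiregular i n (p + j) ∧ subschemeCycle i hi ∈ cyclesOfDim X.left d ∧ a ≠ 0 ∧
      (a : ℂ) • lefschetzPowTo θ j (2 * p) (2 * (p + j)) (two_mul_add_two_mul p j) w + (b : ℂ) • cupPowTwo θ (p + j) =
        subschemeClass hX hdp ρ i hi}

/-- **ONE BLOCH-SEMIREGULAR L.C.I. IN THE SHIFTED DEGREE `2(p + j)` AT EVERY CHART OF ONE SPLIT ANCHOR OF OUR CHOICE, type `(R, e₀, p)`
(`OneSplitWeilAnchorBlochShiftedCarriers R e₀ p j`)** — the `∀∃` chart form of PART AF with Bloch's l.c.i. door in place of `𝒪`: there is a split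
`E`-Weil datum `(X₀, η₀, e', a')` of type `(R, e₀, p)` (André's `(*)`: `IsWeilTypeCM X₀ η₀ R e₀ p`, an `η₀`-compatible hyperplane class `h₀ = e'^*a'`,
`IsHyperbolicWeilType X₀ η₀ (p·e₀) h₀`) such that at EVERY CHART `(X, ε : X₀.X ≅ X, θ)` with `ε^*θ = c·h₀` (`c ∈ ℚˣ`) and `θ` a polarisation class,
SOME non-zero rational class `w` on `X` with `ε^*w` in the `E`-Weil line `weilClassesField X₀ η₀ (R(T²)) (2p)` is carried in the shifted degree:
`w ∈ blochShiftedCarriedClasses (dim X₀) p j X θ` — a Bloch-semiregular local complete intersection `Z ⊂ X` of codimension `p + j` with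
`[Z] = a·θʲw + b·θ^{p+j}`, `a ≠ 0`. With the refereed facts `BlochSemiregularSpreadOfSubscheme (2pe₀) (p + j)` (Bloch (7.4)) and
`andre1996_weilLineFamily_throughSplitAnchor`, and Lieberman's `B(A)` (a theorem of the tree), it serves EVERY split target of the type whenever
`2p + j ≤ 2pe₀` (companion engine `VHCAbelianSchemesRoadWeilLineBlochShifted`). OPEN for every `(R, e₀, p, j)` with `p > 1` (Bloch, Remark (7.5): «the
problem of constructing semi-regular representatives for algebraic cycle classes of codimension `> 1` remains, however, wide open»); NOT implied by the
Hodge conjecture; a HYPOTHESIS wherever used. [cite: Bloch1972Semiregularity, Thm. (7.4) and Remark (7.5) (p. 65)] [cite: Andre1996Motifs, §6.3 b) (*)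
(p. 32), proof of Lemme 6.3.3 (p. 33)] [cite: Deligne1982HodgeCycles, §4 proof of Thm. 4.8, Cor. 4.2] [cite: MoonenZarhin1998WeilClasses, §1]
[cite: Lieberman1968, main theorem] -/
@[conjecture] def OneSplitWeilAnchorBlochShiftedCarriers (R : Polynomial ℤ) (e₀ p j : ℕ) : Prop :=
  ∃ (X₀ : AbelianVariety ℂ) (η₀ : X₀ ⟶ X₀) (e' : ProjectiveEmbedding X₀.X) (a' : complexBetti (projectiveSpace e'.n ℂ) 2),
    IsWeilTypeCM X₀ η₀ R e₀ p ∧ IsRationalClass a' ∧ a' ≠ 0 ∧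
    (∀ x y : complexBetti X₀.X 1,
      polarizationPairingOne X₀.X (complexBetti.map e'.ι 2 a') (X₀.dim - 1) (pullbackOne X₀ η₀ x) y =
        -polarizationPairingOne X₀.X (complexBetti.map e'.ι 2 a') (X₀.dim - 1) x (pullbackOne X₀ η₀ y)) ∧
    IsHyperbolicWeilType X₀ η₀ (p * e₀) (complexBetti.map e'.ι 2 a') ∧
    ∀ (X : SchemeOver ℂ) (ε : X₀.X ≅ X) (θ : complexBetti X 2) (c : ℚ), c ≠ 0 →
      complexBetti.map ε.hom 2 θ = (c : ℂ) • complexBetti.map e'.ι 2 a' → IsPolarizationClass X₀.dim X θ →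
      ∃ w : complexBetti X (2 * p), IsRationalClass w ∧ w ≠ 0 ∧
        complexBetti.map ε.hom (2 * p) w ∈ weilClassesField X₀ η₀ (R.comp (Polynomial.X ^ 2)) (2 * p) ∧
        w ∈ blochShiftedCarriedClasses X₀.dim p j X θ

/-- **THE BLOCH-DOOR `∀`-TYPES NODE, SHIFT FREE PER TYPE (`OneSplitWeilAnchorBlochCarriersAll`)**: whenever some `B` carries a split `E`-Weil datum
`(η, e, a)` of type `(R, e₀, p)` with `p > 1` (the binders of `AndreSplitWeilClasses` verbatim), there is SOME shift `j` with `2p + j ≤ 2pe₀ (= dim)` and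
`OneSplitWeilAnchorBlochShiftedCarriers R e₀ p j`: ONE split anchor of that type, of our choice, at every chart of which some non-zero rational `E`-Weil
class times `θʲ` is, up to `ℚθ^{p+j}` and a non-zero integer, the class of a Bloch-semiregular local complete intersection of codimension `p + j`. With
Bloch (7.4) for the pairs `(2pe₀, p + j)` and the family fact it yields `AndreSplitWeilClasses` (every CM field; companion file), hence — Lemme 6.3.2 being
a theorem of the tree — `HC_CM` with Kodaira, and `HC_AV` with CM-algebraic carriers. OPEN; NOT implied by the Hodge conjecture; a HYPOTHESIS wherever used.
[cite: Bloch1972Semiregularity, Thm. (7.4) and Remark (7.5) (p. 65)] [cite: Andre1996Motifs, §6.3 b)–c) (pp. 32–33)] [cite: Deligne1982HodgeCycles, §4 proof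
of Thm. 4.8] [cite: Lieberman1968, main theorem] -/
@[conjecture] def OneSplitWeilAnchorBlochCarriersAll : Prop :=
  ∀ (R : Polynomial ℤ) (e₀ p : ℕ), 1 < p →
    ∀ (B : AbelianVariety ℂ) (η : B ⟶ B) (e : ProjectiveEmbedding B.X) (a : complexBetti (projectiveSpace e.n ℂ) 2),
      IsWeilTypeCM B η R e₀ p → IsRationalClass a → a ≠ 0 →
      (∀ x y : complexBetti B.X 1,
        polarizationPairingOne B.X (complexBetti.map e.ι 2 a) (B.dim - 1) (pullbackOne B η x) y =
          -polarizationPairingOne B.X (complexBetti.map e.ι 2 a) (B.dim - 1) x (pullbackOne B η y)) →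
      IsHyperbolicWeilType B η (p * e₀) (complexBetti.map e.ι 2 a) →
        ∃ j : ℕ, 2 * p + j ≤ 2 * p * e₀ ∧ OneSplitWeilAnchorBlochShiftedCarriers R e₀ p j

/-- **THE `(8,2)` QUARTIC CELL IN THE SHIFTED DEGREE `2(2 + j)`, BLOCH DOOR (`QuarticSplitEightfoldAnchorBlochCarrier j`)** — the smallest open cell of the
column in its three geometric incarnations (`j = 0`: a semiregular l.c.i. SIXFOLD of class `a·w + b·θ²`; `j = 2`: a semiregular l.c.i. FOURFOLD of class
`a·θ²w + b·θ⁴`; `j = 4`: a semiregular l.c.i. SURFACE of class `a·θ⁴w + b·θ⁶`; `j ∈ {1, 3}` allowed): for every type `(R, 2, 2)` (`E` a QUARTIC CM field,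
`E`-rank 4: abelian EIGHTFOLDS, Weil classes in codimension 2) inhabited by a split datum, ONE split anchor of our choice (e.g. `E₀² ⊗ 𝒪_E`) at every chart
of which some non-zero rational `E`-Weil class is carried in degree `2(2 + j)` by a Bloch-semiregular local complete intersection. With Bloch (7.4) at
`(8, 2 + j)`, the family fact and Lieberman: the codimension-2 Weil classes of EVERY split Weil eightfold of that quartic type (companion file). OPEN for every
`j`: at `j = 0` even the existence of a smooth subvariety in the class is open (ℚ-smoothability outside the Whitney range); at `j = 4` the class is that of
a smooth irreducible surface (Hironaka ∕ Kollár–Voisin) and the open point is semiregularity alone (no complete intersection of six divisors on an abelian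
eightfold is semiregular: `h¹(N) ≥ 1008 > 448 = h^{5,7}`). NOT implied by the Hodge conjecture; a HYPOTHESIS wherever used.
[cite: Bloch1972Semiregularity, Thm. (7.4) and Remark (7.5) (p. 65)] [cite: Markman2025SecantRealMultiplication, §1.1] [cite: Andre2026, §4.4.4]
[cite: Andre1996Motifs, proof of Lemme 6.3.3 (p. 33)] [cite: Lieberman1968, main theorem] -/
@[conjecture] def QuarticSplitEightfoldAnchorBlochCarrier (j : ℕ) : Prop :=
  ∀ R : Polynomial ℤ,
    ∀ (B : AbelianVariety ℂ) (η : B ⟶ B) (e : ProjectiveEmbedding B.X) (a : complexBetti (projectiveSpace e.n ℂ) 2),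
      IsWeilTypeCM B η R 2 2 → IsRationalClass a → a ≠ 0 →
      (∀ x y : complexBetti B.X 1,
        polarizationPairingOne B.X (complexBetti.map e.ι 2 a) (B.dim - 1) (pullbackOne B η x) y =
          -polarizationPairingOne B.X (complexBetti.map e.ι 2 a) (B.dim - 1) x (pullbackOne B η y)) →
      IsHyperbolicWeilType B η (2 * 2) (complexBetti.map e.ι 2 a) →
        OneSplitWeilAnchorBlochShiftedCarriers R 2 2 j

end Summit.HodgeConjecture.HodgeConjecture.Ring2.AbelianAll

end
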